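import Summits.QuantumFields.YangMills.Theorems.UnitScaleTiltProp7CorrectedParamMemberStep
import Summits.QuantumFields.YangMills.Theorems.UnitScaleTiltProp7AvgHessGaugePointwiseIdentity
import HarnessLib

/-!
# (q-gauge) «FR₂-lite» ROAD (route R2) — **THE s-FREE MAJORANT: on the frame-chart ball `‖A(b)‖ ≤ e·η` the frame-corrected gauge parameter of F3∕F4 (the `kappaAt` body whose `s`-derivative
# is `κY`) is bounded AT EVERY TOP SITE by an explicit `A`-independent recursion `M`, with `Σ_x M x ≤ (∏_{j<K−n} θ_j)·((L^(K−n))⁻¹)³·Σ_x ‖N x‖`** — the `hM`∕`hsum` rows of px12 g18's Cauchy door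
# ✓∕⧗`Prop7KappaAtDiscCauchy.sum_norm_kappaY_le_of_majorant`

Cell `ym3-torus` (HUMAN RULING D-0037, YM ladder rung R3 — SU(2) YM₃ on T³: NOT d = 4, NOT infinite volume, NOT a mass gap, NOT Clay).  Width seat `ym3-torus-px16` (gen 15);
THEOREMS ONLY (0 `def`, 0 `sorry`, default heartbeats); `--supports stmt-QuantumFields-19200 --as helper`; count-neutral; NO claim on crux ∕ stub ∕ registry.

THE MATHEMATICS (LOCATE «FR₂-lite», 19200 evidence #53∕#57, route R2).  Along the gauge family `g_t = e^{tN}` acting on the chart-point field `W_A = e^{A}U₀♭` the accumulated frames respond,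
level by level, by w5 g6's ✓`Prop7SymFrameGaugeResponseAt.hasDerivAt_frameAccU_succ_at`; the FRAME-CORRECTED PARAMETER `Λ_j(x) = ν_j(x)⁻¹·(N(x̂⁽ʲ⁾x) − V_j(x)·ν_j(x)⁻¹)·ν_j(x)` then obeys
`Λ_{j+1}(y) = w⁻¹·(Λ_j(ŷ) − E·w⁻¹)·w` (F-A ✓`correctedParam_succ_eq`), and F-B′1 ✓`norm_correctedStep_member_le` bounds it by the perturbed block mean of `‖Λ_j‖` — so the EXPLICIT,
`A`-free recursion `M₀ = ‖N‖`, `M_{j+1}(y) = (1+48δ_j)·|Idx|⁻¹Σ_i M_j(x_i(y)) + 600δ_j·Σ_{x∈B(y)} M_j x` majorises `‖Λ_j‖` pointwise (§2), its mass contracts by `L⁻³·θ_j`, `θ_j = 1 + 48δ_j + 600L³δ_j`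
(F-B ✓`sum_norm_correctedStep_le`∕`sum_norm_correctedTower_le`, §3), and at the top level `Λ_{K−n}(x)` IS the `kappaAt` body of F3∕F4 (`HasDerivAt.unique` against ✓`hasDerivAt_frameAccU_gaugeCopyAt_site`, §4).

WHAT IS PROVED (member `F`, `h : n ≤ K`; `RegPr F n K ε₀ U₀`, windows `10¹²L³ε₀ ≤ 1`, `10⁹L²e ≤ 1`, `0 < e`).
* §1 `delta_le_of_windows` — `δ_j := 60L(2e + 2700Lε₀)·(Lʲη) ≤ 1∕48` for `j ≤ K − n` from the windows.
* §2 ★★ `exists_response_le_majorant` — for every `A` with `‖A(b)‖ ≤ e·η` and every `j ≤ K − n`: `∃ V`, the level-`j` frames respond along `g_t` with derivative `V` AND `‖Λ_j^V(y)‖ ≤ M_j y` for all `y`.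
* §3 ★ `sum_majorant_le` — `Σ_y M_j y ≤ ((L³)⁻¹)^j·(∏_{i<j} θ_i)·Σ_x ‖N x‖`.
* §4 ★★★ `norm_kappaAt_le_majorant` — the `hM` row: `‖w⁻¹·(N(x̂x) − Dw(A)[V_A]·w⁻¹)·w‖ ≤ M_{K−n} x` with F4's x-form text; ★★★ `exists_sfree_majorant` — `∃ M`, (`hsum`) ∧ (`hM` for every `A` in the ball).
HONEST SCOPE.  Bookkeeping over landed∕signed letters; the Cauchy step (px12 g18 F-C) and «FR₂-lite» (F-D) are NOT here; `hqG`, norm_H₁, norm_G, EX, the crux and rung R3 are NOT proved; the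
Yang–Mills mass gap is NOT proved.

References: T. Bałaban, CMP **98** (1985) 17–51 [Balaban1985Averaging] ((11) p.19, (97) p.32, (161)–(163) p.42); CMP **99** (1985) 389–434 [Balaban1985BackgroundPropagators] ((3.19) p.393,
(3.114)–(3.115) p.418); CMP **102** (1985) 277–309 [Balaban1985Variational] ((2) p.278); CMP **109** (1987) 249–301 [Balaban1987RG1] ((0.3)–(0.8) pp.252–253).
-/

set_option autoImplicit false

noncomputable section

open scoped BigOperators Matrix.Norms.L2Operator

namespace Summit.QuantumFields.YangMills.Theorems.Prop7CorrectedParamMajorant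

open Finset NormedSpace
open Literature.MathematicalPhysics.QuantumFieldTheory.Balaban1983to89
open Literature.MathematicalPhysics.QuantumFieldTheory.Balaban1983to89.T3ContinuumYM3Torus
open T4Continuum BlockAveraging ExpMeanLog
open MatrixLog (mlog)
open B10Eq27TorusAxialLog (holT transl gaugeActT gaugeActT_apply)
open B7Prop1Explicit (expUnit disp)
open B7TransferAnalyticMean (meanCLM)
open T3PrintedRegularMinimiser (RegPr)
open T3SectALandauChart (bgUnits eta eta_pos)
open B15DeterminingSets (embIter)
open Summit.QuantumFields.YangMills.Theorems.Prop8Chart (emlIterU)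
open Summit.QuantumFields.YangMills.Theorems.Prop7SymAvgTwSym (tstairU vframeCovU frameAccU frameAccU_succ frameAccU_zero dbarCovIterU pow_mul_eta_le_one)
open Summit.QuantumFields.YangMills.Theorems.Prop7SymFrameGaugeResponseAt (hasDerivAt_frameAccU_succ_at)
open Summit.QuantumFields.YangMills.Theorems.Prop7ChartGaugeCurveAt (gaugeFamily_zero hasDerivAt_gaugeFamily)
open Summit.QuantumFields.YangMills.Theorems.Prop7CorrectedParamLevelBound (correctedParam_succ_eq)
open Summit.QuantumFields.YangMills.Theorems.Prop7CorrectedParamTowerMass (sum_norm_correctedStep_le sum_norm_correctedTower_le)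
open Summit.QuantumFields.YangMills.Theorems.Prop7CorrectedParamMemberStep (norm_tstair_family_sub_one_le norm_correctedStep_member_le)
open Summit.QuantumFields.YangMills.Theorems.Prop7AvgHessGaugePointwiseIdentity (hasDerivAt_frameAccU_gaugeCopyAt_site)

variable (F : T3Family) {n K : ℕ} (h : n ≤ K)

/-! ## §1 The closeness numeral is inside the `1∕48` window -/

/-- **`δ_j ≤ 1∕48`**: `60L(2e + 2700Lε₀)·(Lʲη) ≤ 60·(2·L·e + 2700·L²·ε₀) ≤ 60·(2·10⁻⁹ + 2700·10⁻¹²) ≤ 1∕48` under the windows (`Lʲη ≤ 1`, `L ≥ 1`).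
[cite: Balaban1985Variational, (2) p.278; Balaban1985Averaging, (161)–(163) p.42] -/
theorem delta_le_of_windows {ε₀ e : ℝ} (hε₀ : 0 < ε₀) (he : 0 ≤ e) (hWe : 10 ^ 9 * (F.L : ℝ) ^ 2 * e ≤ 1) (hWε : 10 ^ 12 * (F.L : ℝ) ^ 3 * ε₀ ≤ 1)
    {j : ℕ} (hj : j ≤ K - n) :
    60 * (F.L : ℝ) * ((2 * e + 2700 * (F.L : ℝ) * ε₀) * ((F.L : ℝ) ^ j * eta F n K)) ≤ 1 / 48 := by
  have hL1 : (1 : ℝ) ≤ F.L := by exact_mod_cast (show 1 ≤ F.L by have := F.hL.2; omega)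
  have hη : 0 < eta F n K := eta_pos F n K
  have hLjη : (F.L : ℝ) ^ j * eta F n K ≤ 1 := pow_mul_eta_le_one F hj
  have h0 : 0 ≤ 2 * e + 2700 * (F.L : ℝ) * ε₀ := by positivity
  have hLe : (F.L : ℝ) * e ≤ 1 / 10 ^ 9 := by
    have h2 : 0 ≤ ((F.L : ℝ) - 1) * ((F.L : ℝ) * e) := mul_nonneg (sub_nonneg.2 hL1) (mul_nonneg (by positivity) he)
    nlinarith [h2]
  have hLε : (F.L : ℝ) ^ 2 * ε₀ ≤ 1 / 10 ^ 12 := by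
    have h2 : 0 ≤ ((F.L : ℝ) - 1) * ((F.L : ℝ) ^ 2 * ε₀) := mul_nonneg (sub_nonneg.2 hL1) (mul_nonneg (by positivity) hε₀.le)
    nlinarith [h2]
  calc 60 * (F.L : ℝ) * ((2 * e + 2700 * (F.L : ℝ) * ε₀) * ((F.L : ℝ) ^ j * eta F n K))
      ≤ 60 * (F.L : ℝ) * ((2 * e + 2700 * (F.L : ℝ) * ε₀) * 1) := by gcongr
    _ = 120 * ((F.L : ℝ) * e) + 162000 * ((F.L : ℝ) ^ 2 * ε₀) := by ring
    _ ≤ 120 * (1 / 10 ^ 9) + 162000 * (1 / 10 ^ 12) := by gcongr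
    _ ≤ 1 / 48 := by norm_num

/-! ## §2 The level induction: frame response with an explicit derivative AND the pointwise majorant -/

/-- ★★ **RESPONSE + MAJORANT AT EVERY LEVEL**: for `U₀ ∈ 𝔘(ε₀)`, `‖A(b)‖ ≤ e·η` and `j ≤ K − n` there is a level-`j` derivative field `V` with
`d∕dt|₀ frameAccU j U₀♭ ((e^{A}U₀♭)^{e^{tN}}) y = V y` for every `y`, and the frame-corrected parameter `ν⁻¹(N(x̂y) − V·ν⁻¹)ν` is bounded pointwise by the `A`-FREE recursion
`M_j` (`M₀ = ‖N‖`, `M_{j+1}(y) = (1+48δ_j)·|Idx|⁻¹Σ_i M_j(x_i(y)) + 600δ_j·Σ_{x∈B(y)} M_j x`) — base `frameAccU 0 = 1`; step = w5 g6 ✓`hasDerivAt_frameAccU_succ_at` + F-A `correctedParam_succ_eq` + F-B′1.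
[cite: Balaban1985Averaging, (97) p.32; Balaban1985BackgroundPropagators, (3.19) p.393, (3.114)–(3.115) p.418] -/
theorem exists_response_le_majorant {ε₀ e : ℝ} (hε₀ : 0 < ε₀) (he : 0 ≤ e) (hWe : 10 ^ 9 * (F.L : ℝ) ^ 2 * e ≤ 1) (hWε : 10 ^ 12 * (F.L : ℝ) ^ 3 * ε₀ ≤ 1)
    (U₀ : GaugeField (F.P K) 0 (Matrix.specialUnitaryGroup (Fin 2) ℂ)) (hreg : RegPr F n K ε₀ U₀) (N : Site (F.P K) 0 → Matrix (Fin 2) (Fin 2) ℂ)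
    (A : PBond (F.P K) 0 → Matrix (Fin 2) (Fin 2) ℂ) (hA : ∀ b, ‖A b‖ ≤ e * eta F n K) :
    ∀ j : ℕ, j ≤ K - n → ∃ V : Site (F.P K) j → Matrix (Fin 2) (Fin 2) ℂ,
      (∀ y : Site (F.P K) j, HasDerivAt (fun t : ℝ => ((frameAccU j (bgUnits F K U₀) (gaugeActT (fun z : Site (F.P K) 0 => expUnit ((t : ℂ) • N z))
          (fun b => expUnit (A b) * bgUnits F K U₀ b)) y : (Matrix (Fin 2) (Fin 2) ℂ)ˣ) : Matrix (Fin 2) (Fin 2) ℂ)) (V y) 0) ∧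
      ∀ y : Site (F.P K) j, ‖(((frameAccU j (bgUnits F K U₀) (fun b => expUnit (A b) * bgUnits F K U₀ b) y)⁻¹ : (Matrix (Fin 2) (Fin 2) ℂ)ˣ) : Matrix (Fin 2) (Fin 2) ℂ)
            * (N (embIter j y) - V y * (((frameAccU j (bgUnits F K U₀) (fun b => expUnit (A b) * bgUnits F K U₀ b) y)⁻¹ : (Matrix (Fin 2) (Fin 2) ℂ)ˣ) : Matrix (Fin 2) (Fin 2) ℂ))
            * ((frameAccU j (bgUnits F K U₀) (fun b => expUnit (A b) * bgUnits F K U₀ b) y : (Matrix (Fin 2) (Fin 2) ℂ)ˣ) : Matrix (Fin 2) (Fin 2) ℂ)‖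
        ≤ @Nat.rec (fun j => Site (F.P K) j → ℝ) (fun x : Site (F.P K) 0 => ‖N x‖)
            (fun j (m : Site (F.P K) j → ℝ) (y : Site (F.P K) (j + 1)) =>
              (1 + 48 * (60 * (F.L : ℝ) * ((2 * e + 2700 * (F.L : ℝ) * ε₀) * ((F.L : ℝ) ^ j * eta F n K))))
                  * ((Fintype.card (Idx (F.P K)) : ℝ)⁻¹ * ∑ i : Idx (F.P K), m (transl (emb y) (disp (stairWord i.2.1 (off i.1)))))
                + 600 * (60 * (F.L : ℝ) * ((2 * e + 2700 * (F.L : ℝ) * ε₀) * ((F.L : ℝ) ^ j * eta F n K))) * ∑ x ∈ block y, m x) j y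
  | 0, _ => by
    refine ⟨fun _ => 0, fun y => ?_, fun y => ?_⟩
    · have h1 : (fun t : ℝ => ((frameAccU 0 (bgUnits F K U₀) (gaugeActT (fun z : Site (F.P K) 0 => expUnit ((t : ℂ) • N z))
          (fun b => expUnit (A b) * bgUnits F K U₀ b)) y : (Matrix (Fin 2) (Fin 2) ℂ)ˣ) : Matrix (Fin 2) (Fin 2) ℂ)) = fun _ => 1 := by
        funext t; rw [frameAccU_zero, Units.val_one]
      rw [h1]; exact hasDerivAt_const 0 1
    · simp only [frameAccU_zero, inv_one, Units.val_one, one_mul, mul_one, sub_zero]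
      exact le_rfl
  | j + 1, hj => by
    obtain ⟨V, hV, hm⟩ := exists_response_le_majorant hε₀ he hWe hWε U₀ hreg N A hA j (by omega)
    have hjlt : j < K - n := by omega
    -- letters of the level
    set δ : ℝ := 60 * (F.L : ℝ) * ((2 * e + 2700 * (F.L : ℝ) * ε₀) * ((F.L : ℝ) ^ j * eta F n K)) with hδdef
    have hδ : δ ≤ 1 / 48 := delta_le_of_windows F hε₀ he hWe hWε hjlt.le
    have hδ0 : 0 ≤ δ := by have := eta_pos F n K; positivity
    set W : GaugeField (F.P K) 0 (Matrix (Fin 2) (Fin 2) ℂ)ˣ := fun b => expUnit (A b) * bgUnits F K U₀ b with hWdef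
    -- the level-`j` corrected parameter as a site function
    set Λ : Site (F.P K) j → Matrix (Fin 2) (Fin 2) ℂ := fun x => (((frameAccU j (bgUnits F K U₀) W x)⁻¹ : (Matrix (Fin 2) (Fin 2) ℂ)ˣ) : Matrix (Fin 2) (Fin 2) ℂ)
      * (N (embIter j x) - V x * (((frameAccU j (bgUnits F K U₀) W x)⁻¹ : (Matrix (Fin 2) (Fin 2) ℂ)ˣ) : Matrix (Fin 2) (Fin 2) ℂ))
      * ((frameAccU j (bgUnits F K U₀) W x : (Matrix (Fin 2) (Fin 2) ℂ)ˣ) : Matrix (Fin 2) (Fin 2) ℂ) with hΛdef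
    -- the majorant at level `j`
    set m : Site (F.P K) j → ℝ := @Nat.rec (fun j => Site (F.P K) j → ℝ) (fun x : Site (F.P K) 0 => ‖N x‖)
        (fun j (m : Site (F.P K) j → ℝ) (y : Site (F.P K) (j + 1)) =>
          (1 + 48 * (60 * (F.L : ℝ) * ((2 * e + 2700 * (F.L : ℝ) * ε₀) * ((F.L : ℝ) ^ j * eta F n K))))
              * ((Fintype.card (Idx (F.P K)) : ℝ)⁻¹ * ∑ i : Idx (F.P K), m (transl (emb y) (disp (stairWord i.2.1 (off i.1)))))
            + 600 * (60 * (F.L : ℝ) * ((2 * e + 2700 * (F.L : ℝ) * ε₀) * ((F.L : ℝ) ^ j * eta F n K))) * ∑ x ∈ block y, m x) j with hmdef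
    have hmΛ : ∀ x, ‖Λ x‖ ≤ m x := hm
    -- closeness of the stair family at this level
    have hτ3 : ∀ y : Site (F.P K) (j + 1), ‖(fun i : Idx (F.P K) => ((tstairU (emlIterU j (bgUnits F K U₀)) (dbarCovIterU j (bgUnits F K U₀) W) y i :
        (Matrix (Fin 2) (Fin 2) ℂ)ˣ) : Matrix (Fin 2) (Fin 2) ℂ)) - 1‖ < 1 / 3 := fun y =>
      (norm_tstair_family_sub_one_le F hε₀ he hWe hWε U₀ hreg A hA hjlt y).trans_lt (hδ.trans_lt (by norm_num))
    -- the gauge family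
    have hg0 : (fun z : Site (F.P K) 0 => expUnit (((0 : ℝ) : ℂ) • N z)) = fun _ => 1 := gaugeFamily_zero N
    -- w5 g6's tower step: the level-`j+1` derivative
    refine ⟨fun y => V (emb y) * ((vframeCovU (emlIterU j (bgUnits F K U₀)) (dbarCovIterU j (bgUnits F K U₀) W) y : (Matrix (Fin 2) (Fin 2) ℂ)ˣ) : Matrix (Fin 2) (Fin 2) ℂ) +
        ((frameAccU j (bgUnits F K U₀) W (emb y) : (Matrix (Fin 2) (Fin 2) ℂ)ˣ) : Matrix (Fin 2) (Fin 2) ℂ) *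
          fderiv ℂ (eml : (Idx (F.P K) → Matrix (Fin 2) (Fin 2) ℂ) → Matrix (Fin 2) (Fin 2) ℂ)
            (fun i : Idx (F.P K) => ((tstairU (emlIterU j (bgUnits F K U₀)) (dbarCovIterU j (bgUnits F K U₀) W) y i : (Matrix (Fin 2) (Fin 2) ℂ)ˣ) : Matrix (Fin 2) (Fin 2) ℂ))
            ((fun i : Idx (F.P K) => Λ (emb y)
                - ((holT (dbarCovIterU j (bgUnits F K U₀) W) (emb y) (stairWord i.2.1 (off i.1)) : (Matrix (Fin 2) (Fin 2) ℂ)ˣ) : Matrix (Fin 2) (Fin 2) ℂ)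
                  * Λ (transl (emb y) (disp (stairWord i.2.1 (off i.1))))
                  * (((holT (dbarCovIterU j (bgUnits F K U₀) W) (emb y) (stairWord i.2.1 (off i.1)))⁻¹ : (Matrix (Fin 2) (Fin 2) ℂ)ˣ) : Matrix (Fin 2) (Fin 2) ℂ))
              * fun i : Idx (F.P K) => ((tstairU (emlIterU j (bgUnits F K U₀)) (dbarCovIterU j (bgUnits F K U₀) W) y i : (Matrix (Fin 2) (Fin 2) ℂ)ˣ) : Matrix (Fin 2) (Fin 2) ℂ)),
      fun y => ?_, fun y => ?_⟩
    · -- the derivative: w5 g6 §4, with the direction re-bracketed as a `Pi` product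
      have hD := hasDerivAt_frameAccU_succ_at (bgUnits F K U₀) W hg0 (fun z => hasDerivAt_gaugeFamily N z) j hV y (hτ3 y)
      have hdir : ((fun i : Idx (F.P K) => Λ (emb y)
                - ((holT (dbarCovIterU j (bgUnits F K U₀) W) (emb y) (stairWord i.2.1 (off i.1)) : (Matrix (Fin 2) (Fin 2) ℂ)ˣ) : Matrix (Fin 2) (Fin 2) ℂ)
                  * Λ (transl (emb y) (disp (stairWord i.2.1 (off i.1))))
                  * (((holT (dbarCovIterU j (bgUnits F K U₀) W) (emb y) (stairWord i.2.1 (off i.1)))⁻¹ : (Matrix (Fin 2) (Fin 2) ℂ)ˣ) : Matrix (Fin 2) (Fin 2) ℂ))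
              * fun i : Idx (F.P K) => ((tstairU (emlIterU j (bgUnits F K U₀)) (dbarCovIterU j (bgUnits F K U₀) W) y i : (Matrix (Fin 2) (Fin 2) ℂ)ˣ) : Matrix (Fin 2) (Fin 2) ℂ))
          = fun i : Idx (F.P K) =>
              ((((frameAccU j (bgUnits F K U₀) W (emb y))⁻¹ : (Matrix (Fin 2) (Fin 2) ℂ)ˣ) : Matrix (Fin 2) (Fin 2) ℂ) * (N (embIter j (emb y)) - V (emb y) * (((frameAccU j (bgUnits F K U₀) W (emb y))⁻¹ : (Matrix (Fin 2) (Fin 2) ℂ)ˣ) : Matrix (Fin 2) (Fin 2) ℂ)) *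
                    ((frameAccU j (bgUnits F K U₀) W (emb y) : (Matrix (Fin 2) (Fin 2) ℂ)ˣ) : Matrix (Fin 2) (Fin 2) ℂ) -
                  ((holT (dbarCovIterU j (bgUnits F K U₀) W) (emb y) (stairWord i.2.1 (off i.1)) : (Matrix (Fin 2) (Fin 2) ℂ)ˣ) : Matrix (Fin 2) (Fin 2) ℂ) *
                      ((((frameAccU j (bgUnits F K U₀) W (transl (emb y) (disp (stairWord i.2.1 (off i.1)))))⁻¹ : (Matrix (Fin 2) (Fin 2) ℂ)ˣ) : Matrix (Fin 2) (Fin 2) ℂ) *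
                          (N (embIter j (transl (emb y) (disp (stairWord i.2.1 (off i.1))))) -
                            V (transl (emb y) (disp (stairWord i.2.1 (off i.1)))) *
                              (((frameAccU j (bgUnits F K U₀) W (transl (emb y) (disp (stairWord i.2.1 (off i.1)))))⁻¹ : (Matrix (Fin 2) (Fin 2) ℂ)ˣ) : Matrix (Fin 2) (Fin 2) ℂ)) *
                        ((frameAccU j (bgUnits F K U₀) W (transl (emb y) (disp (stairWord i.2.1 (off i.1)))) : (Matrix (Fin 2) (Fin 2) ℂ)ˣ) : Matrix (Fin 2) (Fin 2) ℂ)) *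
                    (((holT (dbarCovIterU j (bgUnits F K U₀) W) (emb y) (stairWord i.2.1 (off i.1)))⁻¹ : (Matrix (Fin 2) (Fin 2) ℂ)ˣ) : Matrix (Fin 2) (Fin 2) ℂ)) *
                ((tstairU (emlIterU j (bgUnits F K U₀)) (dbarCovIterU j (bgUnits F K U₀) W) y i : (Matrix (Fin 2) (Fin 2) ℂ)ˣ) : Matrix (Fin 2) (Fin 2) ℂ) := by
        funext i; rfl
      dsimp only
      rw [hdir]
      exact hD
    · -- the bound: F-A §1 turns the level-`j+1` parameter into `w⁻¹(Λ(ŷ) − E w⁻¹)w`, F-B′1 bounds it, the majorant is monotone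
      have hsucc : frameAccU (j + 1) (bgUnits F K U₀) W y = frameAccU j (bgUnits F K U₀) W (emb y) * vframeCovU (emlIterU j (bgUnits F K U₀)) (dbarCovIterU j (bgUnits F K U₀) W) y :=
        frameAccU_succ j _ _ y
      dsimp only
      rw [hsucc, correctedParam_succ_eq]
      have hstep := norm_correctedStep_member_le F hε₀ he hWe hWε U₀ hreg A hA hjlt hδ y Λ
      refine hstep.trans ?_
      -- monotonicity of the majorant in the values
      have hM0 : 0 ≤ 1 + 48 * δ := by positivity
      have h1 : (Fintype.card (Idx (F.P K)) : ℝ)⁻¹ * ∑ i : Idx (F.P K), ‖Λ (transl (emb y) (disp (stairWord i.2.1 (off i.1))))‖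
          ≤ (Fintype.card (Idx (F.P K)) : ℝ)⁻¹ * ∑ i : Idx (F.P K), m (transl (emb y) (disp (stairWord i.2.1 (off i.1)))) :=
        mul_le_mul_of_nonneg_left (sum_le_sum fun i _ => hmΛ _) (inv_nonneg.2 (Nat.cast_nonneg _))
      have h2 : ∑ x ∈ block y, ‖Λ x‖ ≤ ∑ x ∈ block y, m x := sum_le_sum fun x _ => hmΛ x
      calc (1 + 48 * δ) * ((Fintype.card (Idx (F.P K)) : ℝ)⁻¹ * ∑ i : Idx (F.P K), ‖Λ (transl (emb y) (disp (stairWord i.2.1 (off i.1))))‖) + 600 * δ * ∑ x ∈ block y, ‖Λ x‖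
          ≤ (1 + 48 * δ) * ((Fintype.card (Idx (F.P K)) : ℝ)⁻¹ * ∑ i : Idx (F.P K), m (transl (emb y) (disp (stairWord i.2.1 (off i.1))))) + 600 * δ * ∑ x ∈ block y, m x := by
            gcongr
        _ = _ := rfl

/-! ## §3 The mass of the majorant: exact geometric bookkeeping -/

/-- ★ **THE MAJORANT'S MASS**: `Σ_y M_j y = ((L^d)⁻¹)^j·(∏_{i<j} θ_i)·Σ_x ‖N x‖` with `θ_i = (1 + 48δ_i) + 600δ_i·L^d` — index mean = block mean, blocks tile the torus (F-B's letters
✓`idxMean_eq_blockMean`, ✓`sum_blockSite_eq`, ✓`sum_sum_block_eq`). [cite: Balaban1985Averaging, (11) p.19, (97) p.32; Balaban1987RG1, (0.3)–(0.4) pp.252–253] -/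
theorem sum_majorant_eq {ε₀ e : ℝ} (N : Site (F.P K) 0 → Matrix (Fin 2) (Fin 2) ℂ) :
    ∀ j : ℕ, j ≤ K - n →
      ∑ y : Site (F.P K) j, @Nat.rec (fun j => Site (F.P K) j → ℝ) (fun x : Site (F.P K) 0 => ‖N x‖)
            (fun j (m : Site (F.P K) j → ℝ) (y : Site (F.P K) (j + 1)) =>
              (1 + 48 * (60 * (F.L : ℝ) * ((2 * e + 2700 * (F.L : ℝ) * ε₀) * ((F.L : ℝ) ^ j * eta F n K))))
                  * ((Fintype.card (Idx (F.P K)) : ℝ)⁻¹ * ∑ i : Idx (F.P K), m (transl (emb y) (disp (stairWord i.2.1 (off i.1)))))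
                + 600 * (60 * (F.L : ℝ) * ((2 * e + 2700 * (F.L : ℝ) * ε₀) * ((F.L : ℝ) ^ j * eta F n K))) * ∑ x ∈ block y, m x) j y
        = ((((F.P K).L : ℝ) ^ (F.P K).d)⁻¹) ^ j
            * (∏ i ∈ range j, ((1 + 48 * (60 * (F.L : ℝ) * ((2 * e + 2700 * (F.L : ℝ) * ε₀) * ((F.L : ℝ) ^ i * eta F n K))))
                + 600 * (60 * (F.L : ℝ) * ((2 * e + 2700 * (F.L : ℝ) * ε₀) * ((F.L : ℝ) ^ i * eta F n K))) * (((F.P K).L : ℝ) ^ (F.P K).d)))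
            * ∑ x : Site (F.P K) 0, ‖N x‖
  | 0, _ => by simp
  | j + 1, hj => by
    have ih := sum_majorant_eq (ε₀ := ε₀) (e := e) N j (by omega)
    have hjmK : j + 1 ≤ (F.P K).m + (F.P K).K := by show j + 1 ≤ F.m + K; omega
    set m : Site (F.P K) j → ℝ := @Nat.rec (fun j => Site (F.P K) j → ℝ) (fun x : Site (F.P K) 0 => ‖N x‖)
        (fun j (m : Site (F.P K) j → ℝ) (y : Site (F.P K) (j + 1)) =>
          (1 + 48 * (60 * (F.L : ℝ) * ((2 * e + 2700 * (F.L : ℝ) * ε₀) * ((F.L : ℝ) ^ j * eta F n K))))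
              * ((Fintype.card (Idx (F.P K)) : ℝ)⁻¹ * ∑ i : Idx (F.P K), m (transl (emb y) (disp (stairWord i.2.1 (off i.1)))))
            + 600 * (60 * (F.L : ℝ) * ((2 * e + 2700 * (F.L : ℝ) * ε₀) * ((F.L : ℝ) ^ j * eta F n K))) * ∑ x ∈ block y, m x) j with hmdef
    set δ : ℝ := 60 * (F.L : ℝ) * ((2 * e + 2700 * (F.L : ℝ) * ε₀) * ((F.L : ℝ) ^ j * eta F n K)) with hδdef
    -- one step: the level-`j+1` mass in terms of the level-`j` mass
    have hmean : ∀ y : Site (F.P K) (j + 1), (Fintype.card (Idx (F.P K)) : ℝ)⁻¹ * ∑ i : Idx (F.P K), m (transl (emb y) (disp (stairWord i.2.1 (off i.1))))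
        = (((F.P K).L : ℝ) ^ (F.P K).d)⁻¹ * ∑ x ∈ block y, m x := fun y => by
      rw [Prop7BlockMeanContraction.idxMean_eq_blockMean m y, LinearLiftGauge.sum_blockSite_eq hjmK y m]
    have hstep : ∑ y : Site (F.P K) (j + 1), ((1 + 48 * δ) * ((Fintype.card (Idx (F.P K)) : ℝ)⁻¹ * ∑ i : Idx (F.P K), m (transl (emb y) (disp (stairWord i.2.1 (off i.1)))))
          + 600 * δ * ∑ x ∈ block y, m x)
        = (((F.P K).L : ℝ) ^ (F.P K).d)⁻¹ * ((1 + 48 * δ) + 600 * δ * (((F.P K).L : ℝ) ^ (F.P K).d)) * ∑ x : Site (F.P K) j, m x := by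
      have hL : (((F.P K).L : ℝ) ^ (F.P K).d) ≠ 0 := pow_ne_zero _ (Nat.cast_ne_zero.2 (F.P K).L_pos.ne')
      calc ∑ y : Site (F.P K) (j + 1), ((1 + 48 * δ) * ((Fintype.card (Idx (F.P K)) : ℝ)⁻¹ * ∑ i : Idx (F.P K), m (transl (emb y) (disp (stairWord i.2.1 (off i.1)))))
              + 600 * δ * ∑ x ∈ block y, m x)
          = ∑ y : Site (F.P K) (j + 1), ((1 + 48 * δ) * (((F.P K).L : ℝ) ^ (F.P K).d)⁻¹ + 600 * δ) * ∑ x ∈ block y, m x :=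
            sum_congr rfl fun y _ => by rw [hmean y]; ring
        _ = ((1 + 48 * δ) * (((F.P K).L : ℝ) ^ (F.P K).d)⁻¹ + 600 * δ) * ∑ x : Site (F.P K) j, m x := by
            rw [← mul_sum, Prop7BlockMeanContraction.sum_sum_block_eq]
        _ = (((F.P K).L : ℝ) ^ (F.P K).d)⁻¹ * ((1 + 48 * δ) + 600 * δ * (((F.P K).L : ℝ) ^ (F.P K).d)) * ∑ x : Site (F.P K) j, m x := by
            field_simp
    show ∑ y : Site (F.P K) (j + 1), ((1 + 48 * δ) * ((Fintype.card (Idx (F.P K)) : ℝ)⁻¹ * ∑ i : Idx (F.P K), m (transl (emb y) (disp (stairWord i.2.1 (off i.1)))))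
          + 600 * δ * ∑ x ∈ block y, m x) = _
    rw [hstep, ih, prod_range_succ]
    ring

/-! ## §4 The top level: the majorant bounds F3∕F4's `kappaAt` body, and the s-free majorant for px12 g18's Cauchy door -/

include h in
/-- ★★★ **THE `hM` ROW**: for `U₀ ∈ 𝔘(ε₀)`, `0 < e`, windows, and every chart point `A` with `‖A(b)‖ ≤ e·η`, the frame-corrected parameter of F3∕F4 at the top site `x` —
`w⁻¹·(N(x̂x) − Dw(A)[V_A]·w⁻¹)·w` with F4's x-form text ✓`hasDerivAt_frameAccU_gaugeCopyAt_site` — is bounded by the `A`-free majorant `M_{K−n} x` (§2 at the top + `HasDerivAt.unique`).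
[cite: Balaban1985BackgroundPropagators, (3.19) p.393, (3.114)–(3.115) p.418; Balaban1985Averaging, (97) p.32] -/
theorem norm_kappaAt_le_majorant {ε₀ e : ℝ} (hε₀ : 0 < ε₀) (he : 0 < e) (hWe : 10 ^ 9 * (F.L : ℝ) ^ 2 * e ≤ 1) (hWε : 10 ^ 12 * (F.L : ℝ) ^ 3 * ε₀ ≤ 1)
    (U₀ : GaugeField (F.P K) 0 (Matrix.specialUnitaryGroup (Fin 2) ℂ)) (hreg : RegPr F n K ε₀ U₀) (N : Site (F.P K) 0 → Matrix (Fin 2) (Fin 2) ℂ)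
    (A : PBond (F.P K) 0 → Matrix (Fin 2) (Fin 2) ℂ) (hA : ∀ b, ‖A b‖ ≤ e * eta F n K) (x : Site (F.P K) (K - n)) :
    ‖(((frameAccU (K - n) (bgUnits F K U₀) (fun b => expUnit (A b) * bgUnits F K U₀ b) x)⁻¹ : (Matrix (Fin 2) (Fin 2) ℂ)ˣ) : Matrix (Fin 2) (Fin 2) ℂ)
        * (N (embIter (K - n) x) - fderiv ℂ (fun A : PBond (F.P K) 0 → Matrix (Fin 2) (Fin 2) ℂ =>
              ((frameAccU (K - n) (bgUnits F K U₀) (fun b => expUnit (A b) * bgUnits F K U₀ b) x : (Matrix (Fin 2) (Fin 2) ℂ)ˣ) : Matrix (Fin 2) (Fin 2) ℂ)) A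
              (fun b : PBond (F.P K) 0 => fderiv ℂ (mlog : Matrix (Fin 2) (Fin 2) ℂ → Matrix (Fin 2) (Fin 2) ℂ) (exp (A b))
                (N b.src * exp (A b) - exp (A b) * (((bgUnits F K U₀ b : (Matrix (Fin 2) (Fin 2) ℂ)ˣ) : Matrix (Fin 2) (Fin 2) ℂ) * N b.tgt
                  * (((bgUnits F K U₀ b)⁻¹ : (Matrix (Fin 2) (Fin 2) ℂ)ˣ) : Matrix (Fin 2) (Fin 2) ℂ))))
            * (((frameAccU (K - n) (bgUnits F K U₀) (fun b => expUnit (A b) * bgUnits F K U₀ b) x)⁻¹ : (Matrix (Fin 2) (Fin 2) ℂ)ˣ) : Matrix (Fin 2) (Fin 2) ℂ))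
        * ((frameAccU (K - n) (bgUnits F K U₀) (fun b => expUnit (A b) * bgUnits F K U₀ b) x : (Matrix (Fin 2) (Fin 2) ℂ)ˣ) : Matrix (Fin 2) (Fin 2) ℂ)‖
      ≤ @Nat.rec (fun j => Site (F.P K) j → ℝ) (fun x : Site (F.P K) 0 => ‖N x‖)
            (fun j (m : Site (F.P K) j → ℝ) (y : Site (F.P K) (j + 1)) =>
              (1 + 48 * (60 * (F.L : ℝ) * ((2 * e + 2700 * (F.L : ℝ) * ε₀) * ((F.L : ℝ) ^ j * eta F n K))))
                  * ((Fintype.card (Idx (F.P K)) : ℝ)⁻¹ * ∑ i : Idx (F.P K), m (transl (emb y) (disp (stairWord i.2.1 (off i.1)))))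
                + 600 * (60 * (F.L : ℝ) * ((2 * e + 2700 * (F.L : ℝ) * ε₀) * ((F.L : ℝ) ^ j * eta F n K))) * ∑ x ∈ block y, m x) (K - n) x := by
  obtain ⟨V, hV, hm⟩ := exists_response_le_majorant F hε₀ he.le hWe hWε U₀ hreg N A hA (K - n) le_rfl
  have hF4 := hasDerivAt_frameAccU_gaugeCopyAt_site F h hε₀ he hWe hWε U₀ hreg N hA x
  have hVx := (hV x).unique hF4
  rw [← hVx]
  exact hm x

include h in
/-- ★★★ **THE s-FREE MAJORANT FOR THE CAUCHY DOOR** (the `hM`∕`hsum` rows of ✓∕⧗`Prop7KappaAtDiscCauchy.sum_norm_kappaY_le_of_majorant`, px12 g18): `∃ M : T^{(K−n)} → ℝ` with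
`Σ_x M x ≤ C_B·((L^{K−n})⁻¹)³·Σ_x‖N x‖`, `C_B := ∏_{j<K−n} ((1 + 48δ_j) + 600δ_j·L³)` (L-ONLY once `δ_j = 60L(2e+2700Lε₀)Lʲη` is summed geometrically), such that for EVERY chart point
`A` of the ball `‖A(b)‖ ≤ e·η` and every top site `x` the `kappaAt` body is `≤ M x`.  For the spike `N = δ_{x₀}⊗A₀`: `Σ‖N‖ = ‖A₀‖`.
[cite: Balaban1985BackgroundPropagators, (3.114)–(3.115) p.418; Balaban1985Averaging, (97) p.32, (161)–(163) p.42] -/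
theorem exists_sfree_majorant {ε₀ e : ℝ} (hε₀ : 0 < ε₀) (he : 0 < e) (hWe : 10 ^ 9 * (F.L : ℝ) ^ 2 * e ≤ 1) (hWε : 10 ^ 12 * (F.L : ℝ) ^ 3 * ε₀ ≤ 1)
    (U₀ : GaugeField (F.P K) 0 (Matrix.specialUnitaryGroup (Fin 2) ℂ)) (hreg : RegPr F n K ε₀ U₀) (N : Site (F.P K) 0 → Matrix (Fin 2) (Fin 2) ℂ) :
    ∃ M : Site (F.P K) (K - n) → ℝ,
      (∑ x : Site (F.P K) (K - n), M x
          ≤ (∏ i ∈ range (K - n), ((1 + 48 * (60 * (F.L : ℝ) * ((2 * e + 2700 * (F.L : ℝ) * ε₀) * ((F.L : ℝ) ^ i * eta F n K))))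
                + 600 * (60 * (F.L : ℝ) * ((2 * e + 2700 * (F.L : ℝ) * ε₀) * ((F.L : ℝ) ^ i * eta F n K))) * (F.L : ℝ) ^ 3))
            * (((F.L : ℝ) ^ (K - n))⁻¹) ^ 3 * ∑ x : Site (F.P K) 0, ‖N x‖) ∧
      ∀ (A : PBond (F.P K) 0 → Matrix (Fin 2) (Fin 2) ℂ), (∀ b, ‖A b‖ ≤ e * eta F n K) → ∀ x : Site (F.P K) (K - n),
        ‖(((frameAccU (K - n) (bgUnits F K U₀) (fun b => expUnit (A b) * bgUnits F K U₀ b) x)⁻¹ : (Matrix (Fin 2) (Fin 2) ℂ)ˣ) : Matrix (Fin 2) (Fin 2) ℂ)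
            * (N (embIter (K - n) x) - fderiv ℂ (fun A : PBond (F.P K) 0 → Matrix (Fin 2) (Fin 2) ℂ =>
                  ((frameAccU (K - n) (bgUnits F K U₀) (fun b => expUnit (A b) * bgUnits F K U₀ b) x : (Matrix (Fin 2) (Fin 2) ℂ)ˣ) : Matrix (Fin 2) (Fin 2) ℂ)) A
                  (fun b : PBond (F.P K) 0 => fderiv ℂ (mlog : Matrix (Fin 2) (Fin 2) ℂ → Matrix (Fin 2) (Fin 2) ℂ) (exp (A b))
                    (N b.src * exp (A b) - exp (A b) * (((bgUnits F K U₀ b : (Matrix (Fin 2) (Fin 2) ℂ)ˣ) : Matrix (Fin 2) (Fin 2) ℂ) * N b.tgt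
                      * (((bgUnits F K U₀ b)⁻¹ : (Matrix (Fin 2) (Fin 2) ℂ)ˣ) : Matrix (Fin 2) (Fin 2) ℂ))))
                * (((frameAccU (K - n) (bgUnits F K U₀) (fun b => expUnit (A b) * bgUnits F K U₀ b) x)⁻¹ : (Matrix (Fin 2) (Fin 2) ℂ)ˣ) : Matrix (Fin 2) (Fin 2) ℂ))
            * ((frameAccU (K - n) (bgUnits F K U₀) (fun b => expUnit (A b) * bgUnits F K U₀ b) x : (Matrix (Fin 2) (Fin 2) ℂ)ˣ) : Matrix (Fin 2) (Fin 2) ℂ)‖ ≤ M x := by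
  refine ⟨_, ?_, fun A hA x => norm_kappaAt_le_majorant F h hε₀ he hWe hWε U₀ hreg N A hA x⟩
  have hd : (F.P K).d = 3 := T3Family.P_d F K
  have hc : (((F.P K).L : ℝ) ^ (F.P K).d) = (F.L : ℝ) ^ 3 := by rw [hd]; rfl
  have hmass := sum_majorant_eq F (ε₀ := ε₀) (e := e) N (K - n) le_rfl
  rw [hc] at hmass
  have hpow : ((((F.L : ℝ)) ^ 3)⁻¹) ^ (K - n) = ((F.L : ℝ) ^ (K - n))⁻¹ ^ 3 := by
    rw [← inv_pow, ← inv_pow, ← pow_mul, ← pow_mul, mul_comm]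
  rw [hmass, hpow]
  exact le_of_eq (by ring)

end Summit.QuantumFields.YangMills.Theorems.Prop7CorrectedParamMajorant

end
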